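import Summits.ABC.ABC.Theorems.TwistAmplificationMazurKaneLawRecordEndgame
import Summits.ABC.ABC.Theorems.TwistAmplificationMazurKaneLawRecordTransfer
import Summits.ABC.ABC.Theorems.TwistAmplificationMazurKaneLawRecordInstanceR74
import Summits.ABC.ABC.Theorems.TwistAmplificationMazurKaneLawRecordInstanceR32
import Summits.ABC.ABC.Theorems.TwistAmplificationMazurKaneLawRecordInstanceR1p
import Summits.ABC.ABC.Theorems.TwistAmplificationMazurKaneLawSlices
import Literature.NumberTheory.DiophantineGeometry.AbcWave0

/-!
# Certified record exponents for the Mazur–Kane count (crux `TwistAmplification.MazurKaneLaw`, stmt-ABC-2757)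

Line `fibre-toolkit-lp-wall-map`, lead c1. The crux (`#{abc, c ≤ N, rad(abc) ≤ c^s} ≤ C N^{s−1+ε}` for `1 < s < 2`)
remains open; what the enlarged fibre toolkit (trivial, subset geometry of numbers, Fourier, determinant, square-root
lattice — all landed) DOES certify, through its exact linear programme, is assembled here:

* `recordAt_74` : `RecordAt (7/4) (49/50)` — for every `s < 7/4` and `ε > 0`,
  `#{abc triples, c ≤ N, rad(abc) ≤ c^s} ≤ C · N^{49/50 + ε}`. This is the first POWER SAVING BELOW KANE'S `N^{1+ε}` on the
  range `s ∈ (37/23, 7/4)` (the 2026 record `min(1, (23s+3)/40)` of Bernert–Browning–Lichtman–Teräväinen v2 / Kane equals `1`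
  there).
* `recordAt_32` : `RecordAt (3/2) (7/8)` — for every `s < 3/2`, exponent `7/8 + ε` (2026 record at `3/2`: `15/16`; trivial `1`).
* `recordAt_1p` : `RecordAt (1001/1000) (31/50)` and its corollary `abcHitCount_le_rpow_thirtyOne_fiftieths`: the number `N(X)` of
  abc HITS (`rad(abc) < c ≤ X`) is `≪_ε X^{31/50 + ε} = X^{0.62+ε}` — below the 2026 records `13/20` (λ = 1, BBLT v2 Thm 1.2) and,
  for the non-strict count at every `s ≤ 1`, below nothing previously certified at `λ = 1` (Thm 1.3's `3/5` needs `λ < 1`). The exact LP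
  value of the enlarged kit at `s = 1` is `0.5826…` (J ≥ 7 levels), so `7/12` is the eventual target of this pipeline.

Each is `recordAt_of_shapeBound ∘ shapeCount_le_of_recordInstance ∘ recordInstance_<tag>`, i.e. generated LP lemma
(`…RecordLP<tag>.lean`) → dictionary instance (`…RecordInstance<tag>.lean`) → generic endgame (`…RecordEndgame.lean`) →
generic transfer (`…RecordTransfer.lean`).
-/

noncomputable section

-- `Summit.<Summit>.<Problem>`: the duplicate `ABC.ABC` is deliberate (single-conjunct summit).
set_option linter.dupNamespace false

namespace Summit.ABC.ABC.Theorems.MazurKaneLaw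

open Summit.ABC.ABC.Theorems.MazurKaneLaw.Toolkit

/-- **Certified record at `s₀ = 7/4`** (registered sub-goal `recordAt_74` of crux stmt-ABC-2757): for every `s < 7/4` and
`ε > 0` there is `C` with `#{abc triples (a,b,c) : c ≤ N, rad(abc) ≤ c^s} ≤ C · N^{49/50 + ε}` for all `N ≥ 2` — the first power
saving below Kane's `N^{1+ε}` for `s ∈ (37/23, 7/4)`. -/
theorem recordAt_74 : Summit.ABC.ABC.Theorems.MazurKaneLaw.Toolkit.RecordAt (7 / 4) (49 / 50) :=
  recordAt_of_shapeBound 3 (7 / 4) (49 / 50) (by norm_num) (by norm_num) (by norm_num) (by norm_num)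
    (shapeCount_le_of_recordInstance 3 (7 / 4) (49 / 50) (by norm_num) (by norm_num) recordInstance_R74)

/-- **Certified record at `s₀ = 3/2`** (registered sub-goal `recordAt_32`): for every `s < 3/2` and `ε > 0`,
`#{abc triples, c ≤ N, rad(abc) ≤ c^s} ≤ C · N^{7/8 + ε}` for `N ≥ 2` (2026 record at `3/2`: exponent `15/16`). -/
theorem recordAt_32 : Summit.ABC.ABC.Theorems.MazurKaneLaw.Toolkit.RecordAt (3 / 2) (7 / 8) :=
  recordAt_of_shapeBound 4 (3 / 2) (7 / 8) (by norm_num) (by norm_num) (by norm_num) (by norm_num)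
    (shapeCount_le_of_recordInstance 4 (3 / 2) (7 / 8) (by norm_num) (by norm_num) recordInstance_R32)

/-- The record at `7/4` in the crux's literal shape: `MazurKaneLaw`'s count with the law's `s − 1` replaced by `49/50`,
for every `s < 7/4` (in particular on `(1, 7/4)`). -/
theorem mazurKane_count_le_rpow_of_lt_seven_fourths (s : ℝ) (hs : s < 7 / 4) (ε : ℝ) (hε : 0 < ε) :
    ∃ C : ℝ, ∀ N : ℕ, 2 ≤ N →
      (Set.ncard {t : ℕ × ℕ × ℕ | Literature.NumberTheory.DiophantineGeometry.IsABCTriple t.1 t.2.1 t.2.2 ∧ t.2.2 ≤ N ∧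
        ((Literature.NumberTheory.DiophantineGeometry.rad t.1 t.2.1 t.2.2 : ℕ) : ℝ) ≤ (t.2.2 : ℝ) ^ s} : ℝ) ≤
        C * (N : ℝ) ^ ((49 / 50 : ℝ) + ε) :=
  recordAt_74 s hs ε hε

/-- The record at `3/2` in the crux's literal shape (exponent `7/8 + ε` for every `s < 3/2`). -/
theorem mazurKane_count_le_rpow_of_lt_three_halves (s : ℝ) (hs : s < 3 / 2) (ε : ℝ) (hε : 0 < ε) :
    ∃ C : ℝ, ∀ N : ℕ, 2 ≤ N →
      (Set.ncard {t : ℕ × ℕ × ℕ | Literature.NumberTheory.DiophantineGeometry.IsABCTriple t.1 t.2.1 t.2.2 ∧ t.2.2 ≤ N ∧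
        ((Literature.NumberTheory.DiophantineGeometry.rad t.1 t.2.1 t.2.2 : ℕ) : ℝ) ≤ (t.2.2 : ℝ) ^ s} : ℝ) ≤
        C * (N : ℝ) ^ ((7 / 8 : ℝ) + ε) :=
  recordAt_32 s hs ε hε

/-- **Certified record at `s₀ = 1001/1000`** (registered sub-goal `recordAt_1p`): for every `s < 1001/1000` (in particular
`s = 1`) and `ε > 0`, `#{abc triples, c ≤ N, rad(abc) ≤ c^s} ≤ C · N^{31/50 + ε}` for `N ≥ 2`. -/
theorem recordAt_1p : Summit.ABC.ABC.Theorems.MazurKaneLaw.Toolkit.RecordAt (1001 / 1000) (31 / 50) :=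
  recordAt_of_shapeBound 4 (1001 / 1000) (31 / 50) (by norm_num) (by norm_num) (by norm_num) (by norm_num)
    (shapeCount_le_of_recordInstance 4 (1001 / 1000) (31 / 50) (by norm_num) (by norm_num) recordInstance_R1p)

/-- **The abc-hit record: `N(X) ≪_ε X^{31/50 + ε}`.** The number of abc hits `(a, b, c)` (`a + b = c` coprime, `rad(abc) < c`)
with `c ≤ X` is at most `C(ε) · X^{0.62 + ε}` for `X ≥ 2` — compare `13/20 = 0.65` (Bernert–Browning–Lichtman–Teräväinen v2,
Thm 1.2 at `λ = 1`, 2026) and `2/3` (trivial). From `recordAt_1p` at `s = 1`: a hit has `rad(abc) < c = c^1`. -/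
theorem abcHitCount_le_rpow_thirtyOne_fiftieths (ε : ℝ) (hε : 0 < ε) :
    ∃ C : ℝ, ∀ X : ℕ, 2 ≤ X →
      (Literature.NumberTheory.DiophantineGeometry.abcHitCount X : ℝ) ≤ C * (X : ℝ) ^ ((31 / 50 : ℝ) + ε) := by
  obtain ⟨C, hC⟩ := recordAt_1p 1 (by norm_num) ε hε
  refine ⟨C, fun X hX => le_trans ?_ (hC X hX)⟩
  have hsub : {t : ℕ × ℕ × ℕ | Literature.NumberTheory.DiophantineGeometry.IsABCTriple t.1 t.2.1 t.2.2 ∧ t.2.2 ≤ X ∧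
        Literature.NumberTheory.DiophantineGeometry.rad t.1 t.2.1 t.2.2 < t.2.2} ⊆
      {t : ℕ × ℕ × ℕ | Literature.NumberTheory.DiophantineGeometry.IsABCTriple t.1 t.2.1 t.2.2 ∧ t.2.2 ≤ X ∧
        ((Literature.NumberTheory.DiophantineGeometry.rad t.1 t.2.1 t.2.2 : ℕ) : ℝ) ≤ (t.2.2 : ℝ) ^ (1 : ℝ)} := by
    rintro t ⟨ht, htX, hlt⟩
    refine ⟨ht, htX, ?_⟩
    rw [Real.rpow_one]
    exact_mod_cast hlt.le
  have hfin : {t : ℕ × ℕ × ℕ | Literature.NumberTheory.DiophantineGeometry.IsABCTriple t.1 t.2.1 t.2.2 ∧ t.2.2 ≤ X ∧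
      ((Literature.NumberTheory.DiophantineGeometry.rad t.1 t.2.1 t.2.2 : ℕ) : ℝ) ≤ (t.2.2 : ℝ) ^ (1 : ℝ)}.Finite :=
    Summit.ABC.ABC.Theorems.MazurKaneLaw.finite_of_isABCTriple X fun _ ht => ⟨ht.1, ht.2.1⟩
  rw [Literature.NumberTheory.DiophantineGeometry.abcHitCount]
  exact_mod_cast Set.ncard_le_ncard hsub hfin

end Summit.ABC.ABC.Theorems.MazurKaneLaw

end
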